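import Summits.QuantumFields.YangMills.Theorems.BalabanUVNodesN18KeyingsModuloN22

/-!
# BalabanUVNodes ∕ N18 — THE KEYINGS COINCIDE MODULO N22, FILE 3: THE RUN-WINDOW KEYING IS STRICTLY WEAKER, EVEN MODULO N22 — a toy over abstract carriers where node N22's letters
# hold (NE9 with fading memory of ALL moduli), g6's RUN-WINDOW NE5 instances (`…N18RunWindowEdge.runWindowShift_of_ne5AtRunWindows`'s `h5run` shape) hold EXACTLY along every
# in-window run of `β ≡ 0`, and BOTH the box letter and the step-matched letter FAIL; so `box ⟺ step-matched (FILE 1, mod N22) ⟹ run-window (g6)` is STRICT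
# (Track A, DAG node N18 = NE5; key K3⁸ `SpineGivenEndpointR13SepCoPHV` = stmt-QuantumFields-27366, skeleton v6 b4e55110ab73e679; width seat `pub-ymgap-dag-n18-w1` g8, FILE 3 — companion
# of FILE 1 `…N18KeyingsModuloN22` and FILE 2 `…N18KeyingsModuloN22Beta`)

HONEST FRAMING.  Count-neutral bookkeeping (`--kind proof --supports stmt-QuantumFields-27366 --as helper`): an explicit toy over ABSTRACT carriers (no Bałaban object), elementary real
arithmetic.  Nothing of Bałaban's is asserted, inhabited, discharged or refuted; NE5 ∕ NE9 NOT PRINTED for d = 4; N18 ∕ N22 NOT discharged; K3⁸ OPEN (v6), no stub proved ∕ refuted, NO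
re-keying done or asked; K3⁷ 20544 aside.  Counts UNMOVED (typed 28∕28 · discharged 5∕27, A 5∕28).  One finite four-torus programme at fixed `ε`, Bałaban AS PRINTED; route R4 closes ONLY
the conditional finite-𝕋⁴ rung `BalabanLadder.UV` — NOT the continuum limit, NOT ℝ⁴, NOT OS, NOT the Yang–Mills mass gap, NOT Clay.  THEOREMS ONLY: 0 `def`, 0 `instance`, 0 `sorry`,
standard axioms.

LOCATED (sharpening FILE 1's consequence (α), for the K3 v7 precut ∕ n27 ∕ the N19′ lanes; nothing asked).  FILE 1: g7's R-N18-SEL ≡ box modulo the bill's `h9` (a cosmetic re-keying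
inside K3).  THIS FILE: g6's R-N18-RUN — NE5 only along the datum's tuned runs (their prefix windows are what BOTH of K3's consumers read: the `hU2` slot via `disc_step` ∕ `Necessity`,
the N19′ edge at run B's own table, g6 evidence #40 item 7) — is a STRICTLY WEAKER obligation than the box conjunct EVEN for a holder of N22's letters; so a v7 that re-keys stub 1's
N18 conjunct changes its CONTENT only if it re-keys to the RUN form, and then weakens it to exactly what print's two-run mechanism ([Balaban1987RG1] Thm 2 ∕ §5: two tuned runs
`K`, `K+1` ending at the same renormalized coupling) supplies — no box, no step graph off the runs.  (A statement about hypothesis SHAPES: no read-out linkage between the law `β ≡ 0` and the toy kernels is assumed — the zero read-out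
represents `β ≡ 0` on any kernels, so the (D4) shape `ReadOutAt` would not restore the box either; whether Bałaban's kernels of record separate the keyings is not claimed.)

WHAT (theorems only; carriers: domains `ℕ` with scale `X ↦ X + 1`, tree length `0`, one-point backgrounds; `EA s X := (−1)^X·(s_X − s_{X−1})` reads the two NEWEST couplings — ages
`0, 1`, genuine UV-fading memory; `EB b s X := (−1)^{X+1}·((b ∷ s)_{X+1} − (b ∷ s)_X)` = FILE 1 §1's link at the level shift): `toyRun_link` · `toyRun_ne9_fading` (NE9 with moduli
`Λ n i = ω⁻²·ω^{n−i}` AND `FadingMemory ω⁻² ω Λ`, any `0 < ω ≤ 1` — node N22's two letters) · `toyRun_run_step` (in-window runs of `β ≡ 0` are constant) · ★ `toyRun_runWindow_exact`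
(g6's `h5run` shape with constant `0`: along runs every difference vanishes) · ★ `toyRun_not_boxLetter` (`γ > 0`, `0 ≤ θ < 1` ⟹ the box letter fails for every `C₅`: at the window history
with the jump `γ∕2 → γ` at level `X` the box difference is `γ` at EVERY member) · ★ `toyRun_not_stepMatched` (law `β ≡ 0`, matched member `b = s 0`: the same history refutes it — consistent
with FILE 1, since N22's letters hold here).

References (TYPES ∕ locators only): [Balaban1987RG1] CMP **109** (1987): (0.20) p. 256, Thm 1 ∕ 2 p. 259, (1.20)–(1.22) p. 264, §5 p. 298.
-/

noncomputable section

namespace YMDAG.N18.KeyingsModuloN22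

open scoped BigOperators
open Literature.MathematicalPhysics.QuantumFieldTheory.Balaban1983to89
open Literature.MathematicalPhysics.QuantumFieldTheory.Balaban1983to89.FlowStep (HBeta RGEqH prefixOf)
open Literature.MathematicalPhysics.QuantumFieldTheory.Balaban1983to89.T4FlagMemory (extd)
open Literature.MathematicalPhysics.QuantumFieldTheory.Balaban1983to89.T4FlagMemoryTwoRun (extd_prefixOf)
open Literature.MathematicalPhysics.QuantumFieldTheory.Balaban1983to89.T4OutputRate (Carriers Functional Window NE5 NE9 FadingMemory mem_window)
open Literature.MathematicalPhysics.QuantumFieldTheory.Balaban1983to89.Node00 (prependCoupling prependCoupling_zero prependCoupling_succ)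

/-! ## §7 The toy: node N22's letters + g6's run-window NE5 instances EXACT along every in-window run of `β ≡ 0`, box AND step-matched letters FALSE

Carriers: domains `ℕ` with scale `X ↦ X + 1`, tree length `0`, one-point backgrounds.  Run A's functional `EA s X := (−1)^X·(s_X − s_{X−1})` (`0` at `X = 0`) reads the two NEWEST couplings (ages `0, 1`: genuine UV-fading memory); run B's family is §1's
link `EB b s X = EA (b ∷ s) (X + 1)`.  Along runs of `β ≡ 0` (constant sequences) every difference vanishes, so g6's `h5run` shape holds with `C₅ = 0`; at the history `(…, γ∕2, γ, γ∕2, …)`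
with the jump at level `X` the box difference is `γ` at every `b`, and so is the step-matched one (`b = s 0`).  So `box ⟺ step-matched` (FILE 1, mod N22) `⟹ run-window` (g6
`runWindowKernelStepRate_of_kernelStepRate`) is STRICT even for a holder of N22: g6's R-N18-RUN — the keying BOTH of K3's consumers read (prefix windows of the tuned runs; g6 evidence
#40 item 7) — is a genuinely weaker obligation than K3's box conjunct, while g7's R-N18-SEL is not. -/

section ToyRun

/-- §1's LINK holds in the second toy. [folklore] -/
theorem toyRun_link :
    let C : Carriers := ⟨ℕ, fun X => X + 1, fun _ => 0, fun _ => le_rfl, PUnit, PUnit, fun _ _ => 0, fun _ _ => le_rfl, id⟩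
    let EA : Functional C C.BgA := fun s _ X => (-1 : ℝ) ^ X * (s X - s (X - 1))
    let EB : ℝ → Functional C C.BgB := fun b s _ X => (-1 : ℝ) ^ (X + 1) * (prependCoupling b s (X + 1) - prependCoupling b s X)
    ∀ (b : ℝ) (g : ℕ → ℝ) (U : C.BgB) (X : C.Dom), EB b g U X = EA (prependCoupling b g) (id U) (X + 1) := by
  intro C EA EB b g U X
  show (-1 : ℝ) ^ (X + 1) * (prependCoupling b g (X + 1) - prependCoupling b g X) =
    (-1 : ℝ) ^ (X + 1) * (prependCoupling b g (X + 1) - prependCoupling b g (X + 1 - 1))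
  rw [Nat.add_sub_cancel]

/-- **NODE N22's LETTERS HOLD**: NE9 with the moduli `Λ n i = ω⁻²·ω^{n−i}` (fading memory with constant `ω⁻²`, rate `ω`, for any `0 < ω ≤ 1`). [folklore] -/
theorem toyRun_ne9_fading {ω : ℝ} (hω : 0 < ω) (hω1 : ω ≤ 1) (γ κ : ℝ) :
    let C : Carriers := ⟨ℕ, fun X => X + 1, fun _ => 0, fun _ => le_rfl, PUnit, PUnit, fun _ _ => 0, fun _ _ => le_rfl, id⟩
    let EA : Functional C C.BgA := fun s _ X => (-1 : ℝ) ^ X * (s X - s (X - 1))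
    NE9 EA (Window γ) κ (fun n i => (ω ^ 2)⁻¹ * ω ^ (n - i)) ∧ FadingMemory (ω ^ 2)⁻¹ ω (fun n i => (ω ^ 2)⁻¹ * ω ^ (n - i)) := by
  intro C EA
  refine ⟨?_, fun n i _ => ⟨by positivity, le_rfl⟩⟩
  intro g _ g' _ U X
  show |(-1 : ℝ) ^ X * (g X - g (X - 1)) - (-1 : ℝ) ^ X * (g' X - g' (X - 1))| ≤
    Real.exp (-(κ * 0)) * ∑ i ∈ Finset.range (X + 1), (ω ^ 2)⁻¹ * ω ^ (X + 1 - i) * |g i - g' i|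
  rw [mul_zero, neg_zero, Real.exp_zero, one_mul]
  cases X with
  | zero =>
    have h0 : |(-1 : ℝ) ^ 0 * (g 0 - g (0 - 1)) - (-1 : ℝ) ^ 0 * (g' 0 - g' (0 - 1))| = 0 := by simp
    rw [h0]
    exact Finset.sum_nonneg fun i _ => by positivity
  | succ m =>
    have hm1 : m + 1 - 1 = m := Nat.add_sub_cancel m 1
    simp only [Nat.succ_eq_add_one, hm1]
    rw [Finset.sum_range_succ, Finset.sum_range_succ]
    have e1 : m + 1 + 1 - (m + 1) = 1 := by omega
    have e2 : m + 1 + 1 - m = 2 := by omega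
    rw [e1, e2, pow_one]
    have hnn : 0 ≤ ∑ i ∈ Finset.range m, (ω ^ 2)⁻¹ * ω ^ (m + 1 + 1 - i) * |g i - g' i| := Finset.sum_nonneg fun i _ => by positivity
    have hB : (ω ^ 2)⁻¹ * ω ^ 2 = 1 := inv_mul_cancel₀ (pow_ne_zero 2 hω.ne')
    have hA : 1 ≤ (ω ^ 2)⁻¹ * ω := by
      rw [← div_eq_inv_mul, le_div_iff₀ (pow_pos hω 2), one_mul]
      nlinarith
    have hlhs : |(-1 : ℝ) ^ (m + 1) * (g (m + 1) - g m) - (-1 : ℝ) ^ (m + 1) * (g' (m + 1) - g' m)| ≤ |g (m + 1) - g' (m + 1)| + |g m - g' m| := by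
      rw [← mul_sub, abs_mul, abs_pow, abs_neg, abs_one, one_pow, one_mul]
      calc |g (m + 1) - g m - (g' (m + 1) - g' m)| = |(g (m + 1) - g' (m + 1)) - (g m - g' m)| := by ring_nf
        _ ≤ |g (m + 1) - g' (m + 1)| + |g m - g' m| := abs_sub _ _
    have hA' : |g (m + 1) - g' (m + 1)| ≤ (ω ^ 2)⁻¹ * ω * |g (m + 1) - g' (m + 1)| :=
      le_mul_of_one_le_left (abs_nonneg _) hA
    rw [hB, one_mul]
    linarith [hlhs, hnn, hA']

/-- In-window runs of the law `β ≡ 0` are CONSTANT: consecutive couplings agree. [folklore] -/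
theorem toyRun_run_step {n : ℕ} {γ : ℝ} {gs : ℕ → ℝ} (hR : RGEqH n (fun _ _ => (0 : ℝ)) gs) (hI : Step.InInterval γ n gs) {i : ℕ} (hi : i < n) :
    gs (i + 1) = gs i := by
  have h := hR i hi
  simp only [add_zero] at h
  have h0 : 0 < gs i := (hI i hi.le).1
  have h1 : 0 < gs (i + 1) := (hI (i + 1) hi).1
  have h2 : gs i ^ 2 = gs (i + 1) ^ 2 := by
    have := congrArg (fun x : ℝ => 1 / x) h
    simpa [one_div_one_div] using this
  exact ((pow_left_inj₀ h0.le h1.le two_ne_zero).mp h2).symm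

/-- ★ **g6's RUN-WINDOW NE5 INSTANCES HOLD EXACTLY** (the `h5run` shape of `…N18RunWindowEdge.runWindowShift_of_ne5AtRunWindows`, constant `0`): along every in-window run of `β ≡ 0` and
every window `j + (k+1) ≤ n`, run A at the padded tail `extd (g_{j+1}, …, g_{j+1+k})` and run B's member at the run's own `g_j` agree at the scale-`(k+1)` point. [folklore] -/
theorem toyRun_runWindow_exact (γ κ θ : ℝ) :
    let C : Carriers := ⟨ℕ, fun X => X + 1, fun _ => 0, fun _ => le_rfl, PUnit, PUnit, fun _ _ => 0, fun _ _ => le_rfl, id⟩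
    let EA : Functional C C.BgA := fun s _ X => (-1 : ℝ) ^ X * (s X - s (X - 1))
    let EB : ℝ → Functional C C.BgB := fun b s _ X => (-1 : ℝ) ^ (X + 1) * (prependCoupling b s (X + 1) - prependCoupling b s X)
    ∀ (n : ℕ) (gs : ℕ → ℝ), RGEqH n (fun _ _ => (0 : ℝ)) gs → Step.InInterval γ n gs → ∀ j k : ℕ, j + (k + 1) ≤ n →
      ∀ (U : C.BgB) (X : C.Dom), C.scale X = k + 1 →
        |EA (extd (prefixOf (fun i => gs (j + 1 + i)) k)) (C.transport U) X - EB (gs j) (extd (prefixOf (fun i => gs (j + 1 + i)) k)) U X| ≤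
          0 * θ ^ (k + 1) * Real.exp (-(κ * C.d X)) := by
  intro C EA EB n gs hR hI j k hjk U X hX
  have hXk : X + 1 = k + 1 := hX
  obtain rfl : X = k := Nat.add_right_cancel hXk
  rw [zero_mul, zero_mul]
  refine le_of_eq (abs_eq_zero.mpr ?_)
  show (-1 : ℝ) ^ X * (extd (prefixOf (fun i => gs (j + 1 + i)) X) X - extd (prefixOf (fun i => gs (j + 1 + i)) X) (X - 1)) -
      (-1 : ℝ) ^ (X + 1) * (prependCoupling (gs j) (extd (prefixOf (fun i => gs (j + 1 + i)) X)) (X + 1) -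
        prependCoupling (gs j) (extd (prefixOf (fun i => gs (j + 1 + i)) X)) X) = 0
  rw [prependCoupling_succ, extd_prefixOf le_rfl, extd_prefixOf (Nat.sub_le X 1)]
  cases X with
  | zero =>
    rw [prependCoupling_zero, Nat.zero_sub, Nat.add_zero, toyRun_run_step hR hI (i := j) (by omega)]
    ring
  | succ m =>
    have hm1 : m + 1 - 1 = m := Nat.add_sub_cancel m 1
    simp only [Nat.succ_eq_add_one, hm1]
    rw [prependCoupling_succ, extd_prefixOf (Nat.le_succ m), show j + 1 + (m + 1) = j + 1 + m + 1 by ring,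
      toyRun_run_step hR hI (i := j + 1 + m) (by omega)]
    ring

/-- **… WHILE THE BOX LETTER FAILS** for every `C₅`, every `0 ≤ θ < 1`, `γ > 0`: at the window history with a jump `γ∕2 → γ` at level `X` the box difference is `γ` for EVERY member `b`,
and `C₅θ^{X+1} → 0`. [folklore] -/
theorem toyRun_not_boxLetter {γ θ : ℝ} (hγ : 0 < γ) (hθ0 : 0 ≤ θ) (hθ1 : θ < 1) (κ C₅ : ℝ) :
    let C : Carriers := ⟨ℕ, fun X => X + 1, fun _ => 0, fun _ => le_rfl, PUnit, PUnit, fun _ _ => 0, fun _ _ => le_rfl, id⟩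
    let EA : Functional C C.BgA := fun s _ X => (-1 : ℝ) ^ X * (s X - s (X - 1))
    let EB : ℝ → Functional C C.BgB := fun b s _ X => (-1 : ℝ) ^ (X + 1) * (prependCoupling b s (X + 1) - prependCoupling b s X)
    ¬ ∀ b, 0 < b → b ≤ γ → NE5 EA (EB b) (Window γ) κ θ C₅ := by
  intro C EA EB h
  have hlim : Filter.Tendsto (fun X : ℕ => C₅ * θ ^ (X + 1)) Filter.atTop (nhds 0) := by
    have h1 := (tendsto_pow_atTop_nhds_zero_of_lt_one hθ0 hθ1).const_mul C₅
    rw [mul_zero] at h1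
    exact h1.comp (Filter.tendsto_add_atTop_nat 1)
  obtain ⟨X, hX, hX1⟩ := ((hlim.eventually (gt_mem_nhds hγ)).and (Filter.eventually_ge_atTop 1)).exists
  -- the window history with the jump at level `X`
  set s : ℕ → ℝ := fun i => if i = X then γ else γ / 2 with hs_def
  have hs : s ∈ Window γ := mem_window.mpr fun i => by
    by_cases hi : i = X
    · simp [hs_def, hi, hγ]
    · simp only [hs_def, hi, if_false]; constructor <;> linarith
  have key := h γ hγ le_rfl s hs PUnit.unit X
  have e : EA s (C.transport PUnit.unit) X - EB γ s PUnit.unit X = (-1 : ℝ) ^ X * (2 * (s X - s (X - 1))) := by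
    show (-1 : ℝ) ^ X * (s X - s (X - 1)) - (-1 : ℝ) ^ (X + 1) * (prependCoupling γ s (X + 1) - prependCoupling γ s X) = _
    obtain ⟨m, rfl⟩ : ∃ m, X = m + 1 := ⟨X - 1, by omega⟩
    rw [prependCoupling_succ, prependCoupling_succ, Nat.add_sub_cancel]
    ring
  have hsX : s X = γ := by simp [hs_def]
  have hsX1 : s (X - 1) = γ / 2 := by
    have : X - 1 ≠ X := by omega
    simp [hs_def, this]
  have hd : Real.exp (-(κ * C.d X)) = 1 := by show Real.exp (-(κ * 0)) = 1; simp
  rw [e, hsX, hsX1, hd, mul_one, abs_mul, abs_pow, abs_neg, abs_one, one_pow, one_mul,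
    show (2 : ℝ) * (γ - γ / 2) = γ by ring, abs_of_pos hγ] at key
  exact absurd key (not_le.mpr hX)

/-- **… AND SO DOES THE STEP-MATCHED LETTER** (law `β ≡ 0`: matched pairs have `b = s 0`; the same jump history refutes it) — consistent with FILE 1 (node N22's letters hold here, so
box and step-matched agree) and showing that g6's run-window keying is STRICTLY weaker than both, even modulo N22. [folklore] -/
theorem toyRun_not_stepMatched {γ θ : ℝ} (hγ : 0 < γ) (hθ0 : 0 ≤ θ) (hθ1 : θ < 1) (κ C₅ : ℝ) :
    let C : Carriers := ⟨ℕ, fun X => X + 1, fun _ => 0, fun _ => le_rfl, PUnit, PUnit, fun _ _ => 0, fun _ _ => le_rfl, id⟩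
    let EA : Functional C C.BgA := fun s _ X => (-1 : ℝ) ^ X * (s X - s (X - 1))
    let EB : ℝ → Functional C C.BgB := fun b s _ X => (-1 : ℝ) ^ (X + 1) * (prependCoupling b s (X + 1) - prependCoupling b s X)
    ¬ ∀ b, 0 < b → b ≤ γ → ∀ s ∈ Window γ, 1 / b ^ 2 = 1 / (s 0) ^ 2 + (fun _ _ => 0 : HBeta) 0 (fun _ => b) →
      ∀ (U : C.BgB) (X : C.Dom), |EA s (C.transport U) X - EB b s U X| ≤ C₅ * θ ^ C.scale X * Real.exp (-(κ * C.d X)) := by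
  intro C EA EB h
  have hlim : Filter.Tendsto (fun X : ℕ => C₅ * θ ^ (X + 1)) Filter.atTop (nhds 0) := by
    have h1 := (tendsto_pow_atTop_nhds_zero_of_lt_one hθ0 hθ1).const_mul C₅
    rw [mul_zero] at h1
    exact h1.comp (Filter.tendsto_add_atTop_nat 1)
  obtain ⟨X, hX, hX2⟩ := ((hlim.eventually (gt_mem_nhds hγ)).and (Filter.eventually_ge_atTop 2)).exists
  set s : ℕ → ℝ := fun i => if i = X then γ else γ / 2 with hs_def
  have hs : s ∈ Window γ := mem_window.mpr fun i => by
    by_cases hi : i = X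
    · simp [hs_def, hi, hγ]
    · simp only [hs_def, hi, if_false]; constructor <;> linarith
  have hs0 : s 0 = γ / 2 := by
    have : (0 : ℕ) ≠ X := by omega
    simp [hs_def, this]
  -- the matched member is `b = s 0 = γ/2`
  have key := h (γ / 2) (by linarith) (by linarith) s hs (by rw [hs0]; simp) PUnit.unit X
  have e : EA s (C.transport PUnit.unit) X - EB (γ / 2) s PUnit.unit X = (-1 : ℝ) ^ X * (2 * (s X - s (X - 1))) := by
    show (-1 : ℝ) ^ X * (s X - s (X - 1)) - (-1 : ℝ) ^ (X + 1) * (prependCoupling (γ / 2) s (X + 1) - prependCoupling (γ / 2) s X) = _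
    obtain ⟨m, rfl⟩ : ∃ m, X = m + 1 := ⟨X - 1, by omega⟩
    rw [prependCoupling_succ, prependCoupling_succ, Nat.add_sub_cancel]
    ring
  have hsX : s X = γ := by simp [hs_def]
  have hsX1 : s (X - 1) = γ / 2 := by
    have : X - 1 ≠ X := by omega
    simp [hs_def, this]
  have hd : Real.exp (-(κ * C.d X)) = 1 := by show Real.exp (-(κ * 0)) = 1; simp
  have hsc : C.scale X = X + 1 := rfl
  rw [e, hsX, hsX1, hd, hsc, mul_one, abs_mul, abs_pow, abs_neg, abs_one, one_pow, one_mul,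
    show (2 : ℝ) * (γ - γ / 2) = γ by ring, abs_of_pos hγ] at key
  exact absurd key (not_le.mpr hX)

end ToyRun

end YMDAG.N18.KeyingsModuloN22

end
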